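/-
Copyright: the b2b-balaban T⁴-continuum CRUX team, row NE7b OWNER lineage `t4-ne7b-p1` (gen 120). Project licence.
-/
import Summits.QuantumFields.BalabanUV.T4Continuum.Spine.NE7b.SupTorusCoarseFloor
import Summits.QuantumFields.BalabanUV.T4Continuum.Spine.NE7b.SupTorusFibreResponse

/-!
# THE ROAD'S NEXT-SCALE OPERATOR IS EXPONENTIALLY LOCAL — BY NAME: for the torus response `Dt` of (100) `torus_exists_response`
# (`Q′t∘Dt = 1`, the linearised covector kills the torus fibre) and the next-scale operator `Mt` of (102) (`(Mt k) y = Q′t((At + u′(φ)·)(Dt k)) y`,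
# whose `(n+1)^d`-multiple IS the Hessian of the next-scale action by (102) `torus_hessian_nextScale_reading`), at EVERY fine field `φ` of the
# two-sided class `−λ ≤ u′(φ ·) ≤ Λ`: `|(Mt e_{y′}) y| ≤ c₁·e^{−δ₁ρ_s(y,y′)}` with `(c₁, δ₁)` depending on `(d, a, λ, Λ)` ONLY — every mesh `n`,
# every period `s`.  The junction of the locality column (130)–(135) with the road's own objects (row NE7b, node U5c; [folklore])

Cell `pub-balaban`, sub-cell `t4`, spine estimate NE7b (`T4WeightBudget.RelWeightBound`; the cell's OWN estimate — NOT PRINTED in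
[Bałaban 1983–89], NOT PROVED).  Crux-route work under `Spine/NE7b/` by the row OWNER (`t4-ne7b-p1` gen 120, file (136)) under FREEZE
(0)'s crux-prover clause; NOTHING of Bałaban's is named as a Lean object, valued or asserted; no `T4Continuum/Support` leaf typed; no `def`,
no notation (every operator enters through its DISPLAYED action, exactly as in (100)∕(102)); zero `sorry`.  Imports (BY NAME): the OWNER's
(135) `…SupTorusCoarseFloor` (`nextScale_hessian_local`; through it (133) `action_injective`, `action_sum_smul`, (89) TDFC `torus_operator_apply`,
`torus_blockAvg_apply`) and (100) `…SupTorusFibreResponse` (`exists_clm_diag`; through it (93) `blockLift_of_critical`), Mathlib's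
`LinearMap.injective_iff_surjective`, `Matrix.inv_eq_right_inv`.

WHY (located).  (135) localises `T⁻¹` for the Schur complement `T` built on block columns `ψ_{y′}` of `H = At + u′(φ)·` given AS DATA.  The
road's next-scale objects are `Dt` and `Mt`; the junction is two remarks: (i) `H` is injective on the finite carrier ((133) `action_injective`),
hence ONTO, so the columns `ψ_{y′}` with `Hψ_{y′} = 𝟙[bt · = y′]` EXIST (chosen inside the proof — no object is defined); (ii) for every `k` the
superposition `Σ_{y″}(Mt k)(y″)ψ_{y″}` and `Dt k` have the same image under `H`, namely the block lift `(Mt k)∘bt` ((93) `blockLift_of_critical`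
on the fibre-killing covector), so they coincide, and `Q′t(Dt k) = k` reads `T·Mt = 1`; thus the matrix of `Mt` is `T⁻¹` and (135) applies.

WHAT IS PROVED ([folklore]): **`nextScale_operator_local`** — `∃ c₁ δ₁ > 0` depending on `(d, a, λ, Λ)` only (`a > 0`, `λ < min(2,a)`,
`Λ ≥ 0`) such that for ALL `n, s`, ALL `Dop, Aop, Ef, Rf, Rc` with the road's displayed actions, ALL `u′, φ` with `−λ ≤ u′(φ x) ≤ Λ`, ALL
`Dt` with `Q′t(Dt k) = k` and the fibre-killing display, ALL `Mt` with (102)'s display: `|(Mt e_{y′}) y| ≤ c₁e^{−δ₁Σ_i|valMinAbs(y i − y′ i)|}`.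
§2 toy.

HONEST (what this is NOT).  The two-sided class only (`u′ ≤ Λ`: `φ⁴` excluded, as in (114)–(123)); the response `Dt` itself and the
fluctuation covariance are localised only through `T⁻¹` and (131) (block-`ℓ²` currency; not typed here); constants explicit in (131)–(135)
but far from sharp; cubic periods; scalar skeleton ((A3), NC-NE7b-α UNRULED); nothing of the covariant propagators; nothing of Bałaban's.
BY-NAME EFFECT ON THE WALL: NONE.  NE7b NOT PRINTED ∕ NOT PROVED; spine PROVED 0∕9; rung (B)+1 on a FINITE torus — NOT infinite volume, NOT
the mass gap, NOT Clay.  HONEST DEPENDENCY: continuum YM on T⁴ ⇐ BetaPertH ∧ nine spine estimates (0∕9 proved); BetaPertH ⇐ (D1) ∧ (D4) ∧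
CAP+tail; G-an2-4 gates asym, D1 and NE2∕3∕4.
-/

set_option autoImplicit false

noncomputable section

namespace Summit.QuantumFields.BalabanUV.T4Continuum.NE7b.SupTorusNextScaleLocality

open Real
open scoped ENNReal
open Literature.MathematicalPhysics.QuantumFieldTheory.Balaban1983to89
open B6QGQLower276 (X e blk B side AX chart mem_B sum_B sum_B_const card_cube blk_chart)
open B5Hk103ScalarZd (nbhd)
open Beta (Site siteOf windowMap siteOf_windowMap siteOf_add)
open SupTorusDirichletFormCoercive (torus_operator_apply torus_blockAvg_apply)
open SupTorusActionMinimiser (blockLift_of_critical)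
open SupTorusFibreResponse (exists_clm_diag)
open SupTorusActionForm (action_injective action_sum_smul)
open SupTorusCoarseFloor (nextScale_hessian_local)

variable {d : ℕ}

/-! ## §1. THE ROAD'S NEXT-SCALE OPERATOR IS EXPONENTIALLY LOCAL — every field of the two-sided class, every mesh, every volume -/

/-- **HEADLINE — THE NEXT-SCALE OPERATOR `Mt` OF THE TORUS ROAD ((100) `torus_exists_response`, (102) `torus_hessian_nextScale_reading`:
`W″(w)[k,k′] = (n+1)^d·Σ_y (Mt k) y·k′ y`) HAS EXPONENTIALLY DECAYING MATRIX ENTRIES, WITH CONSTANTS DEPENDING ON `(d, a, λ, Λ)` ONLY.**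
For every dimension `d`, `a > 0`, `λ < min(2,a)`, `Λ ≥ 0` THERE ARE `c₁, δ₁ > 0` such that: on every pair of tori (mesh `n`, period `s`),
for ANY operators `Aop, Dop, Ef, Rf, Rc` with the road's displayed actions (`At = Rf∘Aop∘Ef`, `Q′t = Rc∘Dop∘Ef`), ANY fine field `φ` and
potential derivative `u′` with `−λ ≤ u′(φ x) ≤ Λ` at every site, ANY response `Dt` (`Q′t∘Dt = 1`, the linearised covector kills the torus
fibre) and ANY `Mt` with the action `(Mt k) y = Q′t((At + u′(φ)·)(Dt k)) y`: `|(Mt e_{y′}) y| ≤ c₁·e^{−δ₁ρ_s(y,y′)}`, `e_{y′}` the coarse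
unit source, `ρ_s` the `ℓ¹` circular distance of (132).  Proof: `H = At + u′(φ)·` is injective hence onto (finite carrier), so the block
columns `ψ_{y′}` (`Hψ_{y′} = 𝟙[bt · = y′]`) exist; the Schur complement `T` of (134) built on them satisfies `T·Mt = 1` (`Σ_{y′}(Mt k)(y′)ψ_{y′}`
and `Dt k` have the same image under `H` — the block lift of `Mt k` — hence coincide, and `Q′t(Dt k) = k`), so `Mt = T⁻¹` entrywise and
(135) `nextScale_hessian_local` applies. [folklore] -/
theorem nextScale_operator_local (a : ℝ) (ha : 0 < a) {lam Lam : ℝ} (hm0 : 0 < min 2 a - lam) (hLam : 0 ≤ Lam) :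
    ∃ c₁ δ₁ : ℝ, 0 < c₁ ∧ 0 < δ₁ ∧ ∀ (n s : ℕ) [NeZero s]
      (Dop Aop : lp (fun _ : X d => ℝ) ∞ →L[ℝ] lp (fun _ : X d => ℝ) ∞),
      (∀ (f : lp (fun _ : X d => ℝ) ∞) (y : X d), Dop f y = (((n : ℝ) + 1) ^ d)⁻¹ * ∑ p ∈ B n y, f p) →
      (∀ (f : lp (fun _ : X d => ℝ) ∞) (p : X d), Aop f p = ∑ r ∈ nbhd n p, AX n a p r * f r) →
      ∀ (Ef : (Site d ((n + 1) * s) → ℝ) →L[ℝ] lp (fun _ : X d => ℝ) ∞),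
      (∀ (g : Site d ((n + 1) * s) → ℝ) (q : X d), Ef g q = g (siteOf d ((n + 1) * s) q)) →
      ∀ (Rf : lp (fun _ : X d => ℝ) ∞ →L[ℝ] (Site d ((n + 1) * s) → ℝ)),
      (∀ (h : lp (fun _ : X d => ℝ) ∞) (x : Site d ((n + 1) * s)), Rf h x = h (windowMap d ((n + 1) * s) x)) →
      ∀ (Rc : lp (fun _ : X d => ℝ) ∞ →L[ℝ] (Site d s → ℝ)),
      (∀ (h : lp (fun _ : X d => ℝ) ∞) (x : Site d s), Rc h x = h (windowMap d s x)) →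
      ∀ (u' : ℝ → ℝ) (φ : Site d ((n + 1) * s) → ℝ), (∀ x, -lam ≤ u' (φ x)) → (∀ x, u' (φ x) ≤ Lam) →
      ∀ (Dt : (Site d s → ℝ) →L[ℝ] (Site d ((n + 1) * s) → ℝ)),
      (∀ k : Site d s → ℝ, ((Rc.comp Dop).comp Ef) (Dt k) = k) →
      (∀ (k : Site d s → ℝ) (κ' : Site d ((n + 1) * s) → ℝ), ((Rc.comp Dop).comp Ef) κ' = 0 →
        ∑ x, (((Rf.comp Aop).comp Ef) (Dt k) x + u' (φ x) * Dt k x) * κ' x = 0) →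
      ∀ (Mt : (Site d s → ℝ) →L[ℝ] (Site d s → ℝ)),
      (∀ (k : Site d s → ℝ) (y : Site d s),
        Mt k y = ((Rc.comp Dop).comp Ef) (fun x => ((Rf.comp Aop).comp Ef) (Dt k) x + u' (φ x) * Dt k x) y) →
      ∀ y y' : Site d s, |Mt (fun y'' => if y'' = y' then 1 else 0) y|
        ≤ c₁ * exp (-(δ₁ * ∑ i, (((y i - y' i).valMinAbs.natAbs : ℕ) : ℝ))) := by
  classical
  obtain ⟨c₁, δ₁, hc₁, hδ₁, H135⟩ := nextScale_hessian_local (d := d) a ha hm0 hLam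
  refine ⟨c₁, δ₁, hc₁, hδ₁, ?_⟩
  intro n s _ Dop Aop hD hA Ef hEf Rf hRf Rc hRc u' φ hu hu' Dt hDQ hDlin Mt hMt y y'
  -- the displayed forms of `At` and `Q′t`
  have hAt : ∀ (h : Site d ((n + 1) * s) → ℝ) (x : Site d ((n + 1) * s)), ((Rf.comp Aop).comp Ef) h x
      = ((n : ℝ) + 1) ^ 2 * ∑ μ, (2 * h x - h (x + siteOf d ((n + 1) * s) (e μ)) - h (x - siteOf d ((n + 1) * s) (e μ)))
        + a / ((n : ℝ) + 1) ^ d * ∑ q ∈ B n (blk n (windowMap d ((n + 1) * s) x)), h (siteOf d ((n + 1) * s) q) := fun h x => by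
    simp only [ContinuousLinearMap.comp_apply]; exact torus_operator_apply n a s hA hEf hRf h x
  have hQt : ∀ (h : Site d ((n + 1) * s) → ℝ) (y : Site d s), ((Rc.comp Dop).comp Ef) h y
      = (((n : ℝ) + 1) ^ d)⁻¹ * ∑ z : Fin d → Fin (n + 1), h (siteOf d ((n + 1) * s) (chart n (windowMap d s y) z)) := fun h y => by
    simp only [ContinuousLinearMap.comp_apply]; exact torus_blockAvg_apply n s hD hEf hRc h y
  -- `H = At + u′(φ)·` as one operator; injective, hence onto
  obtain ⟨N, hN⟩ := exists_clm_diag (ι := Site d ((n + 1) * s)) (fun x => u' (φ x))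
  set Hop : (Site d ((n + 1) * s) → ℝ) →L[ℝ] (Site d ((n + 1) * s) → ℝ) := (Rf.comp Aop).comp Ef + N with hHop_def
  have hHop : ∀ (h : Site d ((n + 1) * s) → ℝ) (x : Site d ((n + 1) * s)), Hop h x
      = ((n : ℝ) + 1) ^ 2 * ∑ μ, (2 * h x - h (x + siteOf d ((n + 1) * s) (e μ)) - h (x - siteOf d ((n + 1) * s) (e μ)))
        + a / ((n : ℝ) + 1) ^ d * ∑ q ∈ B n (blk n (windowMap d ((n + 1) * s) x)), h (siteOf d ((n + 1) * s) q)
        + u' (φ x) * h x := fun h x => by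
    rw [hHop_def, _root_.add_apply, Pi.add_apply, hAt, hN]
  have hinj : Function.Injective Hop := fun u v huv =>
    action_injective n a s ha.le hm0 (fun x => u' (φ x)) hu u v fun x => by rw [← hHop, ← hHop, huv]
  have hsurj : Function.Surjective Hop := by
    have h := (LinearMap.injective_iff_surjective (f := (Hop : (Site d ((n + 1) * s) → ℝ) →ₗ[ℝ] (Site d ((n + 1) * s) → ℝ)))).1
      (fun u v huv => hinj huv)
    exact fun f => h f
  -- the block columns `ψ_{y′}` of `H⁻¹`
  choose ψ hψ using fun y'' : Site d s =>
    hsurj fun x => if siteOf d s (blk n (windowMap d ((n + 1) * s) x)) = y'' then (1 : ℝ) else 0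
  have hψ' : ∀ (y'' : Site d s) (x : Site d ((n + 1) * s)),
      ((n : ℝ) + 1) ^ 2 * ∑ μ, (2 * ψ y'' x - ψ y'' (x + siteOf d ((n + 1) * s) (e μ)) - ψ y'' (x - siteOf d ((n + 1) * s) (e μ)))
        + a / ((n : ℝ) + 1) ^ d * ∑ q ∈ B n (blk n (windowMap d ((n + 1) * s) x)), ψ y'' (siteOf d ((n + 1) * s) q)
        + u' (φ x) * ψ y'' x
      = if siteOf d s (blk n (windowMap d ((n + 1) * s) x)) = y'' then 1 else 0 := fun y'' x => by
    rw [← hHop]; exact congrFun (hψ y'') x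
  have hT := H135 n s (fun x => u' (φ x)) hu hu' ψ hψ'
  -- `T·Mt = 1`: the superposition `Σ_{y″} (Mt k)(y″)·ψ_{y″}` and `Dt k` have the same image under `H`, hence coincide
  have hlift : ∀ (k : Site d s → ℝ) (x : Site d ((n + 1) * s)),
      ((Rf.comp Aop).comp Ef) (Dt k) x + u' (φ x) * Dt k x = Mt k (siteOf d s (blk n (windowMap d ((n + 1) * s) x))) := by
    intro k x
    rw [hMt, ← blockLift_of_critical n s hD hEf hRc (fun x => ((Rf.comp Aop).comp Ef) (Dt k) x + u' (φ x) * Dt k x) (hDlin k) x]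
  have hsuper : ∀ k : Site d s → ℝ, (fun x => ∑ y'', Mt k y'' * ψ y'' x) = Dt k := by
    intro k
    refine action_injective n a s ha.le hm0 (fun x => u' (φ x)) hu _ _ fun x => ?_
    rw [action_sum_smul n a s Finset.univ (Mt k) ψ (fun x => u' (φ x)) x]
    simp only [hψ', mul_ite, mul_one, mul_zero]
    rw [Finset.sum_ite_eq, if_pos (Finset.mem_univ _), ← hlift k x, hAt]
  have hTM : ∀ (k : Site d s → ℝ) (yy : Site d s),
      ∑ y'', ((((n : ℝ) + 1) ^ d)⁻¹ * ∑ z : Fin d → Fin (n + 1), ψ y'' (siteOf d ((n + 1) * s) (chart n (windowMap d s yy) z))) * Mt k y''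
        = k yy := by
    intro k yy
    have h1 := congrFun (hDQ k) yy
    rw [hQt, ← hsuper k] at h1
    rw [← h1, Finset.mul_sum]
    simp only [Finset.mul_sum, Finset.sum_mul]
    rw [Finset.sum_comm]
    exact Finset.sum_congr rfl fun z _ => Finset.sum_congr rfl fun y'' _ => by ring
  -- hence the matrix of `Mt` is `T⁻¹`
  set T : Matrix (Site d s) (Site d s) ℝ := Matrix.of fun yy y'' : Site d s =>
    (((n : ℝ) + 1) ^ d)⁻¹ * ∑ z : Fin d → Fin (n + 1), ψ y'' (siteOf d ((n + 1) * s) (chart n (windowMap d s yy) z)) with hT_def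
  set M : Matrix (Site d s) (Site d s) ℝ := Matrix.of fun yy y'' : Site d s => Mt (fun t => if t = y'' then 1 else 0) yy with hM_def
  have hTM1 : T * M = 1 := by
    ext yy y''
    rw [Matrix.mul_apply]
    simp only [hT_def, hM_def, Matrix.of_apply]
    rw [hTM (fun t => if t = y'' then 1 else 0) yy, Matrix.one_apply]
  have hinv : T⁻¹ = M := Matrix.inv_eq_right_inv hTM1
  have hentry : Mt (fun y'' => if y'' = y' then 1 else 0) y = T⁻¹ y y' := by rw [hinv]; simp only [hM_def, Matrix.of_apply]
  rw [hentry]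
  exact hT y y'

/-! ## §2. Toy -/

/-- Toy: the constants of the headline exist for `d = 4`, `a = 1`, `λ = 1∕2`, `Λ = 3` (the hypotheses are numerals). -/
example : ∃ c₁ δ₁ : ℝ, 0 < c₁ ∧ 0 < δ₁ :=
  let ⟨c₁, δ₁, hc₁, hδ₁, _⟩ := nextScale_operator_local (d := 4) 1 one_pos (lam := 1 / 2) (Lam := 3) (by norm_num) (by norm_num)
  ⟨c₁, δ₁, hc₁, hδ₁⟩

end Summit.QuantumFields.BalabanUV.T4Continuum.NE7b.SupTorusNextScaleLocality
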